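import Summits.CriticalPhenomena.PercolationContinuityZ3.Theorems.SahiBoxTP2TiltReal
import Summits.CriticalPhenomena.PercolationContinuityZ3.Theorems.SahiBoxTP2RealSequences
import Summits.CriticalPhenomena.PercolationContinuityZ3.Theorems.SahiBoxTP2HilbertReindex

/-!
# Box-TP₂ on `ℝ^ℕ` and `ℝ^ι` is preserved by bounded continuous log-supermodular tilts

Support file of the Sahi cell (`prim-sahi`, typer seat, generation 14; `--supports stmt-CriticalPhenomena-4575`).
Theorems only (no definitions, no named facts, no sorries).  Infinite-volume companion of `SahiBoxTP2TiltReal.lean`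
— the setting of lattice fields `φ : ℤ^d → ℝ`.

* `isBoxTP2_of_eventually_map_finRestrict'` — box-TP₂ on `ℕ → X` from box-TP₂ of the initial-segment marginals of
  all large dimensions (no bounded-order hypothesis; continuity from above).
* `IsBoxTP2.withDensity_cylinder_realSeq` — a finite box-TP₂ law on `ℝ^ℕ` tilted by a bounded continuous
  log-supermodular CYLINDER density `ρ₀(u_0,…,u_{D−1})` is box-TP₂ (marginals of dimension `d ≥ D` are the `ℝ^d`
  tilts of `SahiBoxTP2TiltReal.lean`; `IsBoxTP2.map_finRestrict_real`).
* `IsBoxTP2.withDensity_of_continuous_realSeq` — the same for EVERY bounded continuous (product topology)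
  log-supermodular `ρ : ℝ^ℕ → ℝ≥0`: `ρ ∘ pad_D → ρ` boundedly, where `pad_D u = finExtendSeq D (u|_D) 0` freezes the
  coordinates `≥ D` at `0` and commutes with `⊓, ⊔`; setwise convergence + `IsBoxTP2.of_limsup_liminf`.
* `IsBoxTP2.withDensity_exp_of_submodular_realSeq` — Gibbs modifications `e^{−H} ν`, `H` continuous, submodular,
  bounded below.
* `IsBoxTP2.withDensity_of_continuous_realSeq_countable` — `ι → ℝ` for any countable `ι ≃ ℕ` (relabelling).
* `IsBoxTP2.withDensity_cylinder_realSeq_of_lintegral_ne_top` (appended) — INTEGRABLE, possibly unbounded cylinder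
  densities (finite-volume Gibbs factors `e^{−H_Λ}` of lattice fields w.r.t. a box-TP₂ reference law).

With `integral_mul_integral_le_of_isBoxTP2_realSeq` / `msahiE_nonneg_of_isBoxTP2_realSeq_of_sahiConjecture`:
FKG for all bounded measurable monotone functionals, and Sahi positivity of every order given `C_n`, for Gibbs
modifications of box-TP₂ laws on `ℝ^{ℤ^d}`.

No sorries, no new axioms.
-/

noncomputable section

namespace Summit.CriticalPhenomena.PercolationContinuityZ3.Theorems.SahiBoxTP2

open MeasureTheory Set Filter Topology Function Literature.Combinatorics.Sahi2008
open scoped ENNReal NNReal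

/-- **Box-TP₂ on `ℕ → X` from box-TP₂ of the initial-segment marginals of all large dimensions** (any measurable
lattice `X` with measurable boxes). [this work] -/
theorem isBoxTP2_of_eventually_map_finRestrict' {X : Type*} [Lattice X] [MeasurableSpace X]
    {μ : Measure (ℕ → X)} [IsFiniteMeasure μ] (hIcc : ∀ (d : ℕ) (a b : Fin d → X), MeasurableSet (Icc a b))
    (h : ∀ᶠ d in atTop, IsBoxTP2 (μ.map (finRestrict d))) : IsBoxTP2 μ := by
  intro a b a' b'
  have hfin : ∀ s : Set (ℕ → X), μ s ≠ ∞ := fun s => measure_ne_top μ s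
  refine le_of_tendsto_of_tendsto
    (ENNReal.Tendsto.mul (tendsto_map_finRestrict_Icc μ hIcc a b) (Or.inr (hfin _))
      (tendsto_map_finRestrict_Icc μ hIcc a' b') (Or.inr (hfin _)))
    (ENNReal.Tendsto.mul (tendsto_map_finRestrict_Icc μ hIcc (a ⊓ a') (b ⊓ b')) (Or.inr (hfin _))
      (tendsto_map_finRestrict_Icc μ hIcc (a ⊔ a') (b ⊔ b')) (Or.inr (hfin _))) ?_
  filter_upwards [h] with d hd
  exact hd (finRestrict d a) (finRestrict d b) (finRestrict d a') (finRestrict d b')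

section RealSeq

variable {ν : Measure (ℕ → ℝ)} [IsFiniteMeasure ν]

/-- **Cylinder tilts preserve box-TP₂ on `ℝ^ℕ`**: for a finite box-TP₂ measure `ν` on `ℝ^ℕ` and a bounded continuous
log-supermodular `ρ₀ : ℝ^D → ℝ≥0`, the measure `ρ₀(u_0,…,u_{D−1}) · ν` is box-TP₂. [this work] -/
theorem IsBoxTP2.withDensity_cylinder_realSeq (hν : IsBoxTP2 ν) {D : ℕ} {ρ₀ : (Fin D → ℝ) → ℝ≥0}
    (hρc : Continuous ρ₀) {C : ℝ≥0} (hρC : ∀ x, ρ₀ x ≤ C) (hρ : ∀ x y, ρ₀ x * ρ₀ y ≤ ρ₀ (x ⊓ y) * ρ₀ (x ⊔ y)) :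
    IsBoxTP2 (ν.withDensity fun u => (ρ₀ (finRestrict D u) : ℝ≥0∞)) := by
  haveI : IsFiniteMeasure (ν.withDensity fun u => (ρ₀ (finRestrict D u) : ℝ≥0∞)) := by
    refine isFiniteMeasure_withDensity (ne_of_lt ?_)
    calc ∫⁻ u, (ρ₀ (finRestrict D u) : ℝ≥0∞) ∂ν ≤ ∫⁻ _, (C : ℝ≥0∞) ∂ν :=
          lintegral_mono fun u => ENNReal.coe_le_coe.2 (hρC _)
      _ = C * ν univ := lintegral_const _
      _ < ∞ := ENNReal.mul_lt_top ENNReal.coe_lt_top (measure_lt_top _ _)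
  refine isBoxTP2_of_eventually_map_finRestrict' (fun _ _ _ => measurableSet_Icc)
    (eventually_atTop.2 ⟨D, fun d hDd => ?_⟩)
  set π : (Fin d → ℝ) → (Fin D → ℝ) := fun x i => x (Fin.castLE hDd i) with hπ
  have hπc : Continuous π := continuous_pi fun i => continuous_apply (Fin.castLE hDd i)
  set g : (Fin d → ℝ) → ℝ≥0∞ := fun x => (ρ₀ (π x) : ℝ≥0∞) with hg
  have hgm : Measurable g := (ENNReal.continuous_coe.comp (hρc.comp hπc)).measurable
  have hfac : (fun u : ℕ → ℝ => (ρ₀ (finRestrict D u) : ℝ≥0∞)) = g ∘ finRestrict d := by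
    funext u
    rfl
  rw [hfac, map_withDensity_comp ν (measurable_finRestrict d) hgm]
  exact (hν.map_finRestrict_real d).withDensity_of_continuous_real (ν.map (finRestrict d)) (ρ := fun x => ρ₀ (π x))
    (hρc.comp hπc) (C := C) (fun x => hρC _) fun x y => hρ _ _

/-- `a ↦ finExtendSeq D a c : ℝ^D → ℝ^ℕ` is continuous. [folklore] -/
theorem continuous_finExtendSeq {X : Type*} [TopologicalSpace X] (D : ℕ) (c : ℕ → X) :
    Continuous fun a : Fin D → X => finExtendSeq D a c := by
  refine continuous_pi fun i => ?_
  by_cases hi : i < D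
  · simp only [finExtendSeq, dif_pos hi]
    exact continuous_apply _
  · simp only [finExtendSeq, dif_neg hi]
    exact continuous_const

/-- `pad_D u = finExtendSeq D (u|_D) c → u` in the product topology as `D → ∞`. [folklore] -/
theorem tendsto_finExtendSeq_finRestrict {X : Type*} [TopologicalSpace X] (c u : ℕ → X) :
    Tendsto (fun D => finExtendSeq D (finRestrict D u) c) atTop (𝓝 u) := by
  rw [tendsto_pi_nhds]
  intro i
  refine tendsto_atTop_of_eventually_const (i₀ := i + 1) fun D hD => ?_
  rw [finExtendSeq_of_lt _ _ (Nat.lt_of_succ_le hD)]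
  rfl

/-- **Box-TP₂ on `ℝ^ℕ` is preserved by bounded continuous log-supermodular tilts**: for a finite box-TP₂ measure `ν`
on `ℝ^ℕ` (possibly singular) and `ρ : ℝ^ℕ → ℝ≥0` continuous (product topology), bounded, with
`ρ u · ρ v ≤ ρ (u ⊓ v) · ρ (u ⊔ v)`, the tilted measure `ρ · ν` is box-TP₂. [this work] -/
theorem IsBoxTP2.withDensity_of_continuous_realSeq (hν : IsBoxTP2 ν) {ρ : (ℕ → ℝ) → ℝ≥0} (hρc : Continuous ρ)
    {C : ℝ≥0} (hρC : ∀ u, ρ u ≤ C) (hρ : ∀ u v, ρ u * ρ v ≤ ρ (u ⊓ v) * ρ (u ⊔ v)) :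
    IsBoxTP2 (ν.withDensity fun u => (ρ u : ℝ≥0∞)) := by
  haveI : IsFiniteMeasure (ν.withDensity fun u => (ρ u : ℝ≥0∞)) := by
    refine isFiniteMeasure_withDensity (ne_of_lt ?_)
    calc ∫⁻ u, (ρ u : ℝ≥0∞) ∂ν ≤ ∫⁻ _, (C : ℝ≥0∞) ∂ν := lintegral_mono fun u => ENNReal.coe_le_coe.2 (hρC u)
      _ = C * ν univ := lintegral_const _
      _ < ∞ := ENNReal.mul_lt_top ENNReal.coe_lt_top (measure_lt_top _ _)
  set c : ℕ → ℝ := fun _ => 0 with hc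
  -- the cylinder tilts `ρ ∘ pad_D`
  have hcyl : ∀ D, IsBoxTP2 (ν.withDensity fun u => (ρ (finExtendSeq D (finRestrict D u) c) : ℝ≥0∞)) := fun D =>
    hν.withDensity_cylinder_realSeq (ρ₀ := fun a => ρ (finExtendSeq D a c)) (hρc.comp (continuous_finExtendSeq D c))
      (C := C) (fun a => hρC _) fun x y => by
        have h := hρ (finExtendSeq D x c) (finExtendSeq D y c)
        rw [← finExtendSeq_inf, ← finExtendSeq_sup] at h
        exact h
  -- setwise convergence by dominated convergence
  have hconv : ∀ {B : Set (ℕ → ℝ)}, MeasurableSet B →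
      Tendsto (fun D => ν.withDensity (fun u => (ρ (finExtendSeq D (finRestrict D u) c) : ℝ≥0∞)) B) atTop
        (𝓝 (ν.withDensity (fun u => (ρ u : ℝ≥0∞)) B)) := by
    intro B hB
    simp only [withDensity_apply _ hB]
    refine tendsto_lintegral_of_dominated_convergence (μ := ν.restrict B) (fun _ => (C : ℝ≥0∞))
      (fun D => (ENNReal.continuous_coe.comp hρc).measurable.comp
        ((continuous_finExtendSeq D c).measurable.comp (measurable_finRestrict D)))
      (fun D => Eventually.of_forall fun u => ENNReal.coe_le_coe.2 (hρC _))
      (by rw [lintegral_const]; exact ENNReal.mul_ne_top ENNReal.coe_ne_top (measure_ne_top _ _))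
      (Eventually.of_forall fun u => ?_)
    exact (ENNReal.continuous_coe.tendsto _).comp ((hρc.tendsto u).comp (tendsto_finExtendSeq_finRestrict c u))
  refine IsBoxTP2.of_limsup_liminf (L := (atTop : Filter ℕ))
    (μs := fun D => ν.withDensity fun u => (ρ (finExtendSeq D (finRestrict D u) c) : ℝ≥0∞))
    (Eventually.of_forall hcyl) (fun _ => id) (fun _ => id) (fun _ _ _ => rfl) (fun _ _ _ => rfl)
    (fun _ _ _ => rfl) (fun _ _ _ => rfl) (fun D a b => ((hconv measurableSet_Icc).liminf_eq).symm.le)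
    (fun D a b => (hconv measurableSet_Icc).limsup_eq.le) (fun a b => tendsto_const_nhds)

/-- **Gibbs modifications on `ℝ^ℕ`**: for a finite box-TP₂ law `ν` on `ℝ^ℕ` and `H` continuous (product topology),
submodular and bounded below, `e^{−H} · ν` is box-TP₂ — hence (`SahiBoxTP2RealSequences.lean`) FKG for all bounded
measurable monotone functionals and Sahi-positive of every order given `C_n`. [this work] -/
theorem IsBoxTP2.withDensity_exp_of_submodular_realSeq (hν : IsBoxTP2 ν) {H : (ℕ → ℝ) → ℝ} (hHc : Continuous H)
    {m : ℝ} (hHm : ∀ u, m ≤ H u) (hH : ∀ u v, H (u ⊓ v) + H (u ⊔ v) ≤ H u + H v) :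
    IsBoxTP2 (ν.withDensity fun u => ENNReal.ofReal (Real.exp (-H u))) :=
  hν.withDensity_of_continuous_realSeq (ρ := fun u => Real.toNNReal (Real.exp (-H u)))
    (continuous_real_toNNReal.comp (Real.continuous_exp.comp hHc.neg)) (C := Real.toNNReal (Real.exp (-m)))
    (fun u => Real.toNNReal_le_toNNReal (Real.exp_le_exp.2 (by linarith [hHm u]))) fun u v => by
      rw [← Real.toNNReal_mul (Real.exp_pos _).le, ← Real.toNNReal_mul (Real.exp_pos _).le, ← Real.exp_add,
        ← Real.exp_add]
      exact Real.toNNReal_le_toNNReal (Real.exp_le_exp.2 (by linarith [hH u v]))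

end RealSeq

/-! ### Countable index sets `ι ≃ ℕ` (lattice fields on `ℤ^d`) -/

section Countable

variable {ι : Type*} {ν : Measure (ι → ℝ)} [IsFiniteMeasure ν]

/-- **Box-TP₂ on `ℝ^ι` (`ι ≃ ℕ`) is preserved by bounded continuous log-supermodular tilts.** [this work] -/
theorem IsBoxTP2.withDensity_of_continuous_realSeq_countable (e : ι ≃ ℕ) (hν : IsBoxTP2 ν) {ρ : (ι → ℝ) → ℝ≥0}
    (hρc : Continuous ρ) {C : ℝ≥0} (hρC : ∀ u, ρ u ≤ C) (hρ : ∀ u v, ρ u * ρ v ≤ ρ (u ⊓ v) * ρ (u ⊔ v)) :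
    IsBoxTP2 (ν.withDensity fun u => (ρ u : ℝ≥0∞)) := by
  rw [← isBoxTP2_map_reindex_symm_iff e]
  haveI : IsFiniteMeasure (ν.map (reindex (X := ℝ) e).symm) := Measure.isFiniteMeasure_map ν _
  have hrc : Continuous (reindex (X := ℝ) e : (ℕ → ℝ) → ι → ℝ) :=
    continuous_pi fun i => by simpa only [reindex_apply] using continuous_apply (e i)
  have hfac : (fun u : ι → ℝ => (ρ u : ℝ≥0∞)) =
      (fun v : ℕ → ℝ => (ρ (reindex e v) : ℝ≥0∞)) ∘ (reindex (X := ℝ) e).symm := by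
    funext u
    simp only [Function.comp_apply, OrderIso.apply_symm_apply]
  have hgm : Measurable fun v : ℕ → ℝ => (ρ (reindex e v) : ℝ≥0∞) :=
    (ENNReal.continuous_coe.comp (hρc.comp hrc)).measurable
  rw [hfac, map_withDensity_comp ν (measurableEmbedding_reindex_symm e).measurable hgm]
  exact ((isBoxTP2_map_reindex_symm_iff e ν).2 hν).withDensity_of_continuous_realSeq (ρ := fun v => ρ (reindex e v))
    (hρc.comp hrc) (C := C) (fun v => hρC _) fun u v => by
      rw [(reindex (X := ℝ) e).map_inf, (reindex (X := ℝ) e).map_sup]; exact hρ _ _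

/-- **Gibbs modifications on `ℝ^ι`, `ι ≃ ℕ`.** [this work] -/
theorem IsBoxTP2.withDensity_exp_of_submodular_realSeq_countable (e : ι ≃ ℕ) (hν : IsBoxTP2 ν) {H : (ι → ℝ) → ℝ}
    (hHc : Continuous H) {m : ℝ} (hHm : ∀ u, m ≤ H u) (hH : ∀ u v, H (u ⊓ v) + H (u ⊔ v) ≤ H u + H v) :
    IsBoxTP2 (ν.withDensity fun u => ENNReal.ofReal (Real.exp (-H u))) :=
  hν.withDensity_of_continuous_realSeq_countable e (ρ := fun u => Real.toNNReal (Real.exp (-H u)))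
    (continuous_real_toNNReal.comp (Real.continuous_exp.comp hHc.neg)) (C := Real.toNNReal (Real.exp (-m)))
    (fun u => Real.toNNReal_le_toNNReal (Real.exp_le_exp.2 (by linarith [hHm u]))) fun u v => by
      rw [← Real.toNNReal_mul (Real.exp_pos _).le, ← Real.toNNReal_mul (Real.exp_pos _).le, ← Real.exp_add,
        ← Real.exp_add]
      exact Real.toNNReal_le_toNNReal (Real.exp_le_exp.2 (by linarith [hH u v]))

end Countable

/-! ### Integrable (possibly unbounded) cylinder tilts on `ℝ^ℕ` (appended) -/

section Integrable

variable {ν : Measure (ℕ → ℝ)} [IsFiniteMeasure ν]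

/-- **Integrable cylinder tilts preserve box-TP₂ on `ℝ^ℕ`** — the finite-volume Gibbs factor of a lattice field with
respect to a box-TP₂ infinite-volume reference law: for a finite box-TP₂ measure `ν` on `ℝ^ℕ` and a continuous
log-supermodular `ρ₀ : ℝ^D → ℝ≥0` (possibly UNBOUNDED, e.g. `e^{J Σ x_i x_j}`) with `∫ ρ₀(u|_D) dν(u) < ∞`, the measure
`ρ₀(u_0,…,u_{D−1}) · ν` is box-TP₂. [this work] -/
theorem IsBoxTP2.withDensity_cylinder_realSeq_of_lintegral_ne_top (hν : IsBoxTP2 ν) {D : ℕ}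
    {ρ₀ : (Fin D → ℝ) → ℝ≥0} (hρc : Continuous ρ₀) (hρi : ∫⁻ u, (ρ₀ (finRestrict D u) : ℝ≥0∞) ∂ν ≠ ∞)
    (hρ : ∀ x y, ρ₀ x * ρ₀ y ≤ ρ₀ (x ⊓ y) * ρ₀ (x ⊔ y)) :
    IsBoxTP2 (ν.withDensity fun u => (ρ₀ (finRestrict D u) : ℝ≥0∞)) := by
  haveI : IsFiniteMeasure (ν.withDensity fun u => (ρ₀ (finRestrict D u) : ℝ≥0∞)) := isFiniteMeasure_withDensity hρi
  refine isBoxTP2_of_eventually_map_finRestrict' (fun _ _ _ => measurableSet_Icc)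
    (eventually_atTop.2 ⟨D, fun d hDd => ?_⟩)
  set π : (Fin d → ℝ) → (Fin D → ℝ) := fun x i => x (Fin.castLE hDd i) with hπ
  have hπc : Continuous π := continuous_pi fun i => continuous_apply (Fin.castLE hDd i)
  set g : (Fin d → ℝ) → ℝ≥0∞ := fun x => (ρ₀ (π x) : ℝ≥0∞) with hg
  have hgm : Measurable g := (ENNReal.continuous_coe.comp (hρc.comp hπc)).measurable
  have hfac : (fun u : ℕ → ℝ => (ρ₀ (finRestrict D u) : ℝ≥0∞)) = g ∘ finRestrict d := by
    funext u
    rfl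
  have hgi : ∫⁻ x, g x ∂(ν.map (finRestrict d)) ≠ ∞ := by
    rw [lintegral_map hgm (measurable_finRestrict d)]
    exact hρi
  rw [hfac, map_withDensity_comp ν (measurable_finRestrict d) hgm]
  exact (hν.map_finRestrict_real d).withDensity_of_continuous_real_of_lintegral_ne_top (ν.map (finRestrict d))
    (ρ := fun x => ρ₀ (π x)) (hρc.comp hπc) hgi fun x y => hρ _ _

/-- **Finite-volume Gibbs factors with integrable Boltzmann weight**: `e^{−H₀(u|_D)} ν` is box-TP₂ for `ν` finite
box-TP₂ on `ℝ^ℕ`, `H₀ : ℝ^D → ℝ` continuous submodular with `∫ e^{−H₀(u|_D)} dν < ∞`. [this work] -/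
theorem IsBoxTP2.withDensity_cylinder_exp_of_submodular_realSeq (hν : IsBoxTP2 ν) {D : ℕ} {H₀ : (Fin D → ℝ) → ℝ}
    (hHc : Continuous H₀) (hHi : ∫⁻ u, ENNReal.ofReal (Real.exp (-H₀ (finRestrict D u))) ∂ν ≠ ∞)
    (hH : ∀ x y, H₀ (x ⊓ y) + H₀ (x ⊔ y) ≤ H₀ x + H₀ y) :
    IsBoxTP2 (ν.withDensity fun u => ENNReal.ofReal (Real.exp (-H₀ (finRestrict D u)))) :=
  hν.withDensity_cylinder_realSeq_of_lintegral_ne_top (ρ₀ := fun x => Real.toNNReal (Real.exp (-H₀ x)))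
    (continuous_real_toNNReal.comp (Real.continuous_exp.comp hHc.neg)) hHi fun x y => by
      rw [← Real.toNNReal_mul (Real.exp_pos _).le, ← Real.toNNReal_mul (Real.exp_pos _).le, ← Real.exp_add,
        ← Real.exp_add]
      exact Real.toNNReal_le_toNNReal (Real.exp_le_exp.2 (by linarith [hH x y]))

end Integrable

end Summit.CriticalPhenomena.PercolationContinuityZ3.Theorems.SahiBoxTP2
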